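import Summits.CriticalPhenomena.PercolationContinuityZ3.Theorems.PercNearOneGluingNoHeavyQuantFarGate3Coins
import HarnessLib

/-!
# QUANT lane R8, front "FAR beyond trees", layer one — THE DEGREE-THREE GATE AT THE OBSERVER, III: the type-level laws

builds on p205010 (kernel theorem, internal audit signed; external expert review pending)

Support file (`--supports stmt-CriticalPhenomena-4575`), seat `prim-quant-p1` (gen 28); memo
`run/shared/lean/prim/quant/prim-quant-p1-g28/FOR-LEAD-GATE3.md` §2.  Standard axioms; no sorries; no definitions.

Setting of files I–II: observer `o`; relay `v` with positive pairs only `s(o,v)` (`p`), `s(v,u₁)` (`r₁`), `s(v,u₂)` (`r₂`) towards relays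
`u₁, u₂`.  Off-`v` events (read off `Bundle.offZ {v}`, independent of the three pairs): `G₁ = [o ~ u₁ off v]`, `G₂ = [o ~ u₂ off v]`,
`H = [u₁ ~ u₂ off v]`.  Integrating the pointwise picture of file I over the eight states of the three pairs (file II):
* **`Gate3.real_card_le_one_le`** — `P(#{a ∈ A : o ↔ a} ≤ 1) ≤ (p(1−r₁)(1−r₂) + (1−p)r₁r₂)·P(¬G₁∧¬G₂) + (1−p)r₁(1−r₂)·P(¬G₁)
  + (1−p)(1−r₁)r₂·P(¬G₂) + (1−p)(1−r₁)(1−r₂)·P(¬(G₁∧G₂))` (the event "at most one of `v, u₁, u₂` is joined to `o`");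
* **`Gate3.real_compl_openConn_u₁_eq`** — `P(o ↮ u₁) = p(1−r₁)r₂·P(¬G₁∧¬H) + (1−p)r₁r₂·P(¬G₁∧¬G₂) + (p(1−r₁)(1−r₂) + (1−p)(1−r₁r₂))·P(¬G₁)`,
  and symmetrically **`Gate3.real_compl_openConn_u₂_eq`**;
* the linear relations among the off-`v` events: `Gate3.real_offv_incl_excl` (`P(¬(G₁∧G₂)) = P(¬G₁) + P(¬G₂) − P(¬G₁∧¬G₂)`),
  `Gate3.real_offv_cover₁/₂` (`P(¬G₁) ≤ P(¬G₁∧¬H) + P(¬G₁∧¬G₂)`, by transitivity of `~ off v`), `Gate3.real_offv_mono₁/₂`.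
[cite: Grimmett1999, §1.3 p. 10; §2.2]; the bookkeeping is [this work].
-/

noncomputable section

namespace Summit.CriticalPhenomena.PercolationContinuityZ3.Theorems

namespace Quant

namespace Gate3

open Finset MeasureTheory Set
open Literature.Probability.LatticeModels
open Literature.Probability.Percolation
open Bundle (offZ reachable_of_offZ)
open scoped Classical

variable {n : ℕ} {o v u₁ u₂ : Fin n}

/-! ## Linear relations among the off-`v` events (any finite measure) -/

/-- Inclusion–exclusion: `P(¬(G₁ ∧ G₂)) = P(¬G₁) + P(¬G₂) − P(¬G₁ ∧ ¬G₂)`. [folklore] -/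
theorem real_offv_incl_excl (μ : Measure (BondConfig (Fin n))) [IsFiniteMeasure μ] :
    μ.real {ω : BondConfig (Fin n) | ¬ ((openGraph (offZ {v} ω)).Reachable o u₁ ∧ (openGraph (offZ {v} ω)).Reachable o u₂)} =
      μ.real {ω : BondConfig (Fin n) | ¬ (openGraph (offZ {v} ω)).Reachable o u₁} +
        μ.real {ω : BondConfig (Fin n) | ¬ (openGraph (offZ {v} ω)).Reachable o u₂} -
        μ.real {ω : BondConfig (Fin n) | ¬ (openGraph (offZ {v} ω)).Reachable o u₁ ∧ ¬ (openGraph (offZ {v} ω)).Reachable o u₂} := by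
  have s1 := EarHair.real_eq_add_of_split μ
    {ω : BondConfig (Fin n) | ¬ ((openGraph (offZ {v} ω)).Reachable o u₁ ∧ (openGraph (offZ {v} ω)).Reachable o u₂)}
    {ω : BondConfig (Fin n) | ¬ (openGraph (offZ {v} ω)).Reachable o u₁}
    {ω : BondConfig (Fin n) | (openGraph (offZ {v} ω)).Reachable o u₁ ∧ ¬ (openGraph (offZ {v} ω)).Reachable o u₂}
    (fun ω => by simp only [Set.mem_setOf_eq]; tauto) (fun ω h h' => h h'.1)
  have s2 := EarHair.real_eq_add_of_split μ
    {ω : BondConfig (Fin n) | ¬ (openGraph (offZ {v} ω)).Reachable o u₂}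
    {ω : BondConfig (Fin n) | ¬ (openGraph (offZ {v} ω)).Reachable o u₁ ∧ ¬ (openGraph (offZ {v} ω)).Reachable o u₂}
    {ω : BondConfig (Fin n) | (openGraph (offZ {v} ω)).Reachable o u₁ ∧ ¬ (openGraph (offZ {v} ω)).Reachable o u₂}
    (fun ω => by simp only [Set.mem_setOf_eq]; tauto) (fun ω h h' => h.1 h'.1)
  linarith

/-- `P(¬G₁) ≤ P(¬G₁ ∧ ¬[u₂ ~ u₁ off v]) + P(¬G₁ ∧ ¬G₂)` (if `¬G₁` and `u₂ ~ u₁` then `¬G₂`, by transitivity). [this work] -/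
theorem real_offv_cover₁ (μ : Measure (BondConfig (Fin n))) [IsFiniteMeasure μ] :
    μ.real {ω : BondConfig (Fin n) | ¬ (openGraph (offZ {v} ω)).Reachable o u₁} ≤
      μ.real {ω : BondConfig (Fin n) | ¬ (openGraph (offZ {v} ω)).Reachable o u₁ ∧ ¬ (openGraph (offZ {v} ω)).Reachable u₂ u₁} +
        μ.real {ω : BondConfig (Fin n) | ¬ (openGraph (offZ {v} ω)).Reachable o u₁ ∧ ¬ (openGraph (offZ {v} ω)).Reachable o u₂} := by
  refine (measureReal_mono ?_).trans (measureReal_union_le _ _)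
  intro ω hω
  simp only [Set.mem_setOf_eq, Set.mem_union] at hω ⊢
  by_cases hH : (openGraph (offZ {v} ω)).Reachable u₂ u₁
  · exact Or.inr ⟨hω, fun h2 => hω (h2.trans hH)⟩
  · exact Or.inl ⟨hω, hH⟩

/-- `P(¬G₂) ≤ P(¬G₂ ∧ ¬[u₁ ~ u₂ off v]) + P(¬G₁ ∧ ¬G₂)`. [this work] -/
theorem real_offv_cover₂ (μ : Measure (BondConfig (Fin n))) [IsFiniteMeasure μ] :
    μ.real {ω : BondConfig (Fin n) | ¬ (openGraph (offZ {v} ω)).Reachable o u₂} ≤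
      μ.real {ω : BondConfig (Fin n) | ¬ (openGraph (offZ {v} ω)).Reachable o u₂ ∧ ¬ (openGraph (offZ {v} ω)).Reachable u₁ u₂} +
        μ.real {ω : BondConfig (Fin n) | ¬ (openGraph (offZ {v} ω)).Reachable o u₁ ∧ ¬ (openGraph (offZ {v} ω)).Reachable o u₂} := by
  refine (measureReal_mono ?_).trans (measureReal_union_le _ _)
  intro ω hω
  simp only [Set.mem_setOf_eq, Set.mem_union] at hω ⊢
  by_cases hH : (openGraph (offZ {v} ω)).Reachable u₁ u₂
  · exact Or.inr ⟨fun h1 => hω (h1.trans hH), hω⟩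
  · exact Or.inl ⟨hω, hH⟩

/-- `P(¬G₁ ∧ ¬G₂) ≤ P(¬G₁)`. [folklore] -/
theorem real_offv_mono₁ (μ : Measure (BondConfig (Fin n))) [IsFiniteMeasure μ] :
    μ.real {ω : BondConfig (Fin n) | ¬ (openGraph (offZ {v} ω)).Reachable o u₁ ∧ ¬ (openGraph (offZ {v} ω)).Reachable o u₂} ≤
      μ.real {ω : BondConfig (Fin n) | ¬ (openGraph (offZ {v} ω)).Reachable o u₁} :=
  measureReal_mono fun ω hω => hω.1

/-- `P(¬G₁ ∧ ¬G₂) ≤ P(¬G₂)`. [folklore] -/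
theorem real_offv_mono₂ (μ : Measure (BondConfig (Fin n))) [IsFiniteMeasure μ] :
    μ.real {ω : BondConfig (Fin n) | ¬ (openGraph (offZ {v} ω)).Reachable o u₁ ∧ ¬ (openGraph (offZ {v} ω)).Reachable o u₂} ≤
      μ.real {ω : BondConfig (Fin n) | ¬ (openGraph (offZ {v} ω)).Reachable o u₂} :=
  measureReal_mono fun ω hω => hω.2

/-- The empty event has probability zero (bookkeeping helper). [folklore] -/
theorem real_offv_false (μ : Measure (BondConfig (Fin n))) [IsFiniteMeasure μ] :
    μ.real {_ω : BondConfig (Fin n) | False} = 0 := by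
  have : {_ω : BondConfig (Fin n) | False} = (∅ : Set (BondConfig (Fin n))) := by ext ω; simp
  rw [this, measureReal_empty]

/-! ## The laws -/

section Law

variable (w : Sym2 (Fin n) → unitInterval)
  (hw : ∀ z : Fin n, z ≠ o → z ≠ u₁ → z ≠ u₂ → z ≠ v → (w s(v, z) : ℝ) = 0)
  (hov : o ≠ v) (h1v : u₁ ≠ v) (h2v : u₂ ≠ v) (ho1 : o ≠ u₁) (ho2 : o ≠ u₂) (h12 : u₁ ≠ u₂)
include hw hov h1v h2v ho1 ho2 h12


/-- **Upper bound for `P(N ≤ 1)`** by the event "at most one of `v, u₁, u₂` is joined to `o`", integrated over the eight states of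
the three pairs (`v, u₁, u₂ ∈ A` distinct relays). [this work] -/
theorem real_card_le_one_le (A : Finset (Fin n)) (hvA : v ∈ A) (h1A : u₁ ∈ A) (h2A : u₂ ∈ A) :
    (prodBernoulli w).real {ω : BondConfig (Fin n) | (A.filter fun a => ω ∈ openConn o a).card ≤ 1} ≤
      (w s(o, v) : ℝ) * ((1 - w s(v, u₁)) * (1 - w s(v, u₂))) *
          (prodBernoulli w).real {ω : BondConfig (Fin n) |
            ¬ (openGraph (offZ {v} ω)).Reachable o u₁ ∧ ¬ (openGraph (offZ {v} ω)).Reachable o u₂} +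
        (1 - (w s(o, v) : ℝ)) * (w s(v, u₁) * w s(v, u₂)) *
          (prodBernoulli w).real {ω : BondConfig (Fin n) |
            ¬ (openGraph (offZ {v} ω)).Reachable o u₁ ∧ ¬ (openGraph (offZ {v} ω)).Reachable o u₂} +
        (1 - (w s(o, v) : ℝ)) * (w s(v, u₁) * (1 - w s(v, u₂))) *
          (prodBernoulli w).real {ω : BondConfig (Fin n) | ¬ (openGraph (offZ {v} ω)).Reachable o u₁} +
        (1 - (w s(o, v) : ℝ)) * ((1 - w s(v, u₁)) * w s(v, u₂)) *
          (prodBernoulli w).real {ω : BondConfig (Fin n) | ¬ (openGraph (offZ {v} ω)).Reachable o u₂} +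
        (1 - (w s(o, v) : ℝ)) * ((1 - w s(v, u₁)) * (1 - w s(v, u₂))) *
          (prodBernoulli w).real {ω : BondConfig (Fin n) |
            ¬ ((openGraph (offZ {v} ω)).Reachable o u₁ ∧ (openGraph (offZ {v} ω)).Reachable o u₂)} := by
  -- pointwise: in each state, `N ≤ 1` forces an off-`v` event
  have step : ∀ (P : Prop → Prop → Prop → Prop) (Q : BondConfig (Fin n) → Prop),
      (∀ ω, (∀ z : Fin n, z ≠ o → z ≠ u₁ → z ≠ u₂ → z ≠ v → s(v, z) ∉ ω) →
        P (s(o, v) ∈ ω) (s(v, u₁) ∈ ω) (s(v, u₂) ∈ ω) →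
        ¬ (((openGraph ω).Reachable o v ∧ (openGraph ω).Reachable o u₁) ∨
          ((openGraph ω).Reachable o v ∧ (openGraph ω).Reachable o u₂) ∨
          ((openGraph ω).Reachable o u₁ ∧ (openGraph ω).Reachable o u₂)) → Q (offZ {v} ω)) →
      (prodBernoulli w).real ({ω : BondConfig (Fin n) | (A.filter fun a => ω ∈ openConn o a).card ≤ 1} ∩
          {ω : BondConfig (Fin n) | P (s(o, v) ∈ ω) (s(v, u₁) ∈ ω) (s(v, u₂) ∈ ω)}) ≤
        (prodBernoulli w).real {ω : BondConfig (Fin n) | P (s(o, v) ∈ ω) (s(v, u₁) ∈ ω) (s(v, u₂) ∈ ω)} *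
          (prodBernoulli w).real {ω | Q (offZ {v} ω)} := by
    intro P Q hPQ
    exact real_inter_state_le w hw _ P Q fun ω hω hP hx =>
      hPQ ω hω hP (not_two_of_card_le_one hvA h1A h2A h1v h2v h12 hx)
  -- the reach lemmas on a good configuration
  have RV : ∀ ω : BondConfig (Fin n), (∀ z : Fin n, z ≠ o → z ≠ u₁ → z ≠ u₂ → z ≠ v → s(v, z) ∉ ω) →
      ((openGraph ω).Reachable o v ↔ s(o, v) ∈ ω ∨ (s(v, u₁) ∈ ω ∧ (openGraph (offZ {v} ω)).Reachable o u₁) ∨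
        (s(v, u₂) ∈ ω ∧ (openGraph (offZ {v} ω)).Reachable o u₂)) := fun ω hω => reach_v_iff hω hov h1v h2v
  have RU1 : ∀ ω : BondConfig (Fin n), (∀ z : Fin n, z ≠ o → z ≠ u₁ → z ≠ u₂ → z ≠ v → s(v, z) ∉ ω) →
      ((openGraph (offZ {v} ω)).Reachable o u₁ → (openGraph ω).Reachable o u₁) := fun ω _ h => reachable_of_offZ h
  have RU2 : ∀ ω : BondConfig (Fin n), (∀ z : Fin n, z ≠ o → z ≠ u₁ → z ≠ u₂ → z ≠ v → s(v, z) ∉ ω) →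
      ((openGraph (offZ {v} ω)).Reachable o u₂ → (openGraph ω).Reachable o u₂) := fun ω _ h => reachable_of_offZ h
  have RU1' : ∀ ω : BondConfig (Fin n), (∀ z : Fin n, z ≠ o → z ≠ u₁ → z ≠ u₂ → z ≠ v → s(v, z) ∉ ω) →
      (openGraph ω).Reachable o v → s(v, u₁) ∈ ω → (openGraph ω).Reachable o u₁ := by
    intro ω _ hv h1
    have e : (openGraph ω).Adj v u₁ := by rw [openGraph_adj]; exact ⟨h1, h1v.symm⟩
    exact hv.trans e.reachable
  have RU2' : ∀ ω : BondConfig (Fin n), (∀ z : Fin n, z ≠ o → z ≠ u₁ → z ≠ u₂ → z ≠ v → s(v, z) ∉ ω) →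
      (openGraph ω).Reachable o v → s(v, u₂) ∈ ω → (openGraph ω).Reachable o u₂ := by
    intro ω _ hv h2
    have e : (openGraph ω).Adj v u₂ := by rw [openGraph_adj]; exact ⟨h2, h2v.symm⟩
    exact hv.trans e.reachable
  -- the eight states
  have b1 := step (fun a b c => a ∧ b ∧ c) (fun _ => False) (by
    rintro ω hω ⟨hp, h1, -⟩ hN
    exact hN (Or.inl ⟨(RV ω hω).2 (Or.inl hp), RU1' ω hω ((RV ω hω).2 (Or.inl hp)) h1⟩))
  have b2 := step (fun a b c => a ∧ b ∧ ¬ c) (fun _ => False) (by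
    rintro ω hω ⟨hp, h1, -⟩ hN
    exact hN (Or.inl ⟨(RV ω hω).2 (Or.inl hp), RU1' ω hω ((RV ω hω).2 (Or.inl hp)) h1⟩))
  have b3 := step (fun a b c => a ∧ ¬ b ∧ c) (fun _ => False) (by
    rintro ω hω ⟨hp, -, h2⟩ hN
    exact hN (Or.inr (Or.inl ⟨(RV ω hω).2 (Or.inl hp), RU2' ω hω ((RV ω hω).2 (Or.inl hp)) h2⟩)))
  have b4 := step (fun a b c => a ∧ ¬ b ∧ ¬ c)
    (fun η => ¬ (openGraph η).Reachable o u₁ ∧ ¬ (openGraph η).Reachable o u₂) (by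
    rintro ω hω ⟨hp, -, -⟩ hN
    have hv := (RV ω hω).2 (Or.inl hp)
    exact ⟨fun h => hN (Or.inl ⟨hv, RU1 ω hω h⟩), fun h => hN (Or.inr (Or.inl ⟨hv, RU2 ω hω h⟩))⟩)
  have b5 := step (fun a b c => ¬ a ∧ b ∧ c)
    (fun η => ¬ (openGraph η).Reachable o u₁ ∧ ¬ (openGraph η).Reachable o u₂) (by
    rintro ω hω ⟨-, h1, h2⟩ hN
    refine ⟨fun h => hN (Or.inl ⟨(RV ω hω).2 (Or.inr (Or.inl ⟨h1, h⟩)), RU1 ω hω h⟩),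
      fun h => hN (Or.inr (Or.inl ⟨(RV ω hω).2 (Or.inr (Or.inr ⟨h2, h⟩)), RU2 ω hω h⟩))⟩)
  have b6 := step (fun a b c => ¬ a ∧ b ∧ ¬ c) (fun η => ¬ (openGraph η).Reachable o u₁) (by
    rintro ω hω ⟨-, h1, -⟩ hN h
    exact hN (Or.inl ⟨(RV ω hω).2 (Or.inr (Or.inl ⟨h1, h⟩)), RU1 ω hω h⟩))
  have b7 := step (fun a b c => ¬ a ∧ ¬ b ∧ c) (fun η => ¬ (openGraph η).Reachable o u₂) (by
    rintro ω hω ⟨-, -, h2⟩ hN h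
    exact hN (Or.inr (Or.inl ⟨(RV ω hω).2 (Or.inr (Or.inr ⟨h2, h⟩)), RU2 ω hω h⟩)))
  have b8 := step (fun a b c => ¬ a ∧ ¬ b ∧ ¬ c)
    (fun η => ¬ ((openGraph η).Reachable o u₁ ∧ (openGraph η).Reachable o u₂)) (by
    rintro ω hω ⟨-, -, -⟩ hN ⟨h1, h2⟩
    exact hN (Or.inr (Or.inr ⟨RU1 ω hω h1, RU2 ω hω h2⟩)))
  rw [real_offv_false, mul_zero] at b1 b2 b3
  rw [real_state_occ (v := v) w ho1 ho2 h12] at b4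
  rw [real_state_coo (v := v) w ho1 ho2 h12] at b5
  rw [real_state_coc (v := v) w ho1 ho2 h12] at b6
  rw [real_state_cco (v := v) w ho1 ho2 h12] at b7
  rw [real_state_ccc (v := v) w ho1 ho2 h12] at b8
  rw [real_split₈ (prodBernoulli w) {ω : BondConfig (Fin n) | (A.filter fun a => ω ∈ openConn o a).card ≤ 1}
    s(o, v) s(v, u₁) s(v, u₂)]
  linarith [b1, b2, b3, b4, b5, b6, b7, b8]

/-- **Law of the cut at `u₁`**: `P(o ↮ u₁) = p(1−r₁)r₂·P(¬G₁ ∧ ¬[u₂ ~ u₁ off v]) + (1−p)r₁r₂·P(¬G₁∧¬G₂) +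
(p(1−r₁)(1−r₂) + (1−p)(r₁(1−r₂) + (1−r₁)r₂ + (1−r₁)(1−r₂)))·P(¬G₁)`. [this work] -/
theorem real_compl_openConn_u₁_eq :
    (prodBernoulli w).real (openConn o u₁ : Set (BondConfig (Fin n)))ᶜ =
      (w s(o, v) : ℝ) * ((1 - w s(v, u₁)) * w s(v, u₂)) *
          (prodBernoulli w).real {ω : BondConfig (Fin n) |
            ¬ (openGraph (offZ {v} ω)).Reachable o u₁ ∧ ¬ (openGraph (offZ {v} ω)).Reachable u₂ u₁} +
        (1 - (w s(o, v) : ℝ)) * (w s(v, u₁) * w s(v, u₂)) *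
          (prodBernoulli w).real {ω : BondConfig (Fin n) |
            ¬ (openGraph (offZ {v} ω)).Reachable o u₁ ∧ ¬ (openGraph (offZ {v} ω)).Reachable o u₂} +
        ((w s(o, v) : ℝ) * ((1 - w s(v, u₁)) * (1 - w s(v, u₂))) + (1 - (w s(o, v) : ℝ)) * (w s(v, u₁) * (1 - w s(v, u₂))) +
            (1 - (w s(o, v) : ℝ)) * ((1 - w s(v, u₁)) * w s(v, u₂)) + (1 - (w s(o, v) : ℝ)) * ((1 - w s(v, u₁)) * (1 - w s(v, u₂)))) *
          (prodBernoulli w).real {ω : BondConfig (Fin n) | ¬ (openGraph (offZ {v} ω)).Reachable o u₁} := by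
  have step : ∀ (P : Prop → Prop → Prop → Prop) (Q : BondConfig (Fin n) → Prop),
      (∀ ω, (∀ z : Fin n, z ≠ o → z ≠ u₁ → z ≠ u₂ → z ≠ v → s(v, z) ∉ ω) →
        P (s(o, v) ∈ ω) (s(v, u₁) ∈ ω) (s(v, u₂) ∈ ω) → (¬ (openGraph ω).Reachable o u₁ ↔ Q (offZ {v} ω))) →
      (prodBernoulli w).real ((openConn o u₁ : Set (BondConfig (Fin n)))ᶜ ∩
          {ω : BondConfig (Fin n) | P (s(o, v) ∈ ω) (s(v, u₁) ∈ ω) (s(v, u₂) ∈ ω)}) =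
        (prodBernoulli w).real {ω : BondConfig (Fin n) | P (s(o, v) ∈ ω) (s(v, u₁) ∈ ω) (s(v, u₂) ∈ ω)} *
          (prodBernoulli w).real {ω | Q (offZ {v} ω)} := by
    intro P Q hPQ
    exact real_inter_state_eq w hw _ P Q fun ω hω hP => hPQ ω hω hP
  have R : ∀ ω : BondConfig (Fin n), (∀ z : Fin n, z ≠ o → z ≠ u₁ → z ≠ u₂ → z ≠ v → s(v, z) ∉ ω) →
      ((openGraph ω).Reachable o u₁ ↔ (openGraph (offZ {v} ω)).Reachable o u₁ ∨
        ((s(o, v) ∈ ω ∨ (s(v, u₁) ∈ ω ∧ (openGraph (offZ {v} ω)).Reachable o u₁) ∨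
            (s(v, u₂) ∈ ω ∧ (openGraph (offZ {v} ω)).Reachable o u₂)) ∧
          ((s(v, u₁) ∈ ω ∧ (openGraph (offZ {v} ω)).Reachable u₁ u₁) ∨
            (s(v, u₂) ∈ ω ∧ (openGraph (offZ {v} ω)).Reachable u₂ u₁)))) :=
    fun ω hω => reach_iff_of_ne hω hov h1v h2v h1v
  have b1 := step (fun a b c => a ∧ b ∧ c) (fun _ => False) (by
    rintro ω hω ⟨hp, h1, -⟩
    rw [R ω hω]; simp only [iff_false, not_not]
    exact Or.inr ⟨Or.inl hp, Or.inl ⟨h1, SimpleGraph.Reachable.refl _⟩⟩)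
  have b2 := step (fun a b c => a ∧ b ∧ ¬ c) (fun _ => False) (by
    rintro ω hω ⟨hp, h1, -⟩
    rw [R ω hω]; simp only [iff_false, not_not]
    exact Or.inr ⟨Or.inl hp, Or.inl ⟨h1, SimpleGraph.Reachable.refl _⟩⟩)
  have b3 := step (fun a b c => a ∧ ¬ b ∧ c)
    (fun η => ¬ (openGraph η).Reachable o u₁ ∧ ¬ (openGraph η).Reachable u₂ u₁) (by
    rintro ω hω ⟨hp, h1, h2⟩
    rw [R ω hω]
    constructor
    · intro h
      simp only [not_or] at h
      refine ⟨h.1, fun hH => h.2 ⟨Or.inl hp, Or.inr ⟨h2, hH⟩⟩⟩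
    · rintro ⟨hG, hH⟩ (h | ⟨-, ⟨h1', -⟩ | ⟨-, hH'⟩⟩)
      · exact hG h
      · exact h1 h1'
      · exact hH hH')
  have b4 := step (fun a b c => a ∧ ¬ b ∧ ¬ c) (fun η => ¬ (openGraph η).Reachable o u₁) (by
    rintro ω hω ⟨-, h1, h2⟩
    rw [R ω hω]
    constructor
    · intro h hG; exact h (Or.inl hG)
    · rintro hG (h | ⟨-, ⟨h1', -⟩ | ⟨h2', -⟩⟩)
      · exact hG h
      · exact h1 h1'
      · exact h2 h2')
  have b5 := step (fun a b c => ¬ a ∧ b ∧ c)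
    (fun η => ¬ (openGraph η).Reachable o u₁ ∧ ¬ (openGraph η).Reachable o u₂) (by
    rintro ω hω ⟨hp, h1, h2⟩
    rw [R ω hω]
    constructor
    · intro h
      exact ⟨fun hG => h (Or.inl hG),
        fun hG2 => h (Or.inr ⟨Or.inr (Or.inr ⟨h2, hG2⟩), Or.inl ⟨h1, SimpleGraph.Reachable.refl _⟩⟩)⟩
    · rintro ⟨hG1, hG2⟩ (h | ⟨hV, -⟩)
      · exact hG1 h
      · rcases hV with h | ⟨-, h⟩ | ⟨-, h⟩
        · exact hp h
        · exact hG1 h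
        · exact hG2 h)
  have b6 := step (fun a b c => ¬ a ∧ b ∧ ¬ c) (fun η => ¬ (openGraph η).Reachable o u₁) (by
    rintro ω hω ⟨hp, -, h2⟩
    rw [R ω hω]
    constructor
    · intro h hG; exact h (Or.inl hG)
    · rintro hG (h | ⟨hV, -⟩)
      · exact hG h
      · rcases hV with h | ⟨-, h⟩ | ⟨h, -⟩
        · exact hp h
        · exact hG h
        · exact h2 h)
  have b7 := step (fun a b c => ¬ a ∧ ¬ b ∧ c) (fun η => ¬ (openGraph η).Reachable o u₁) (by
    rintro ω hω ⟨hp, h1, -⟩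
    rw [R ω hω]
    constructor
    · intro h hG; exact h (Or.inl hG)
    · rintro hG (h | ⟨hV, hout⟩)
      · exact hG h
      · rcases hV with h | ⟨h, -⟩ | ⟨-, hG2⟩
        · exact hp h
        · exact h1 h
        · rcases hout with ⟨h, -⟩ | ⟨-, hH⟩
          · exact h1 h
          · exact hG (hG2.trans hH))
  have b8 := step (fun a b c => ¬ a ∧ ¬ b ∧ ¬ c) (fun η => ¬ (openGraph η).Reachable o u₁) (by
    rintro ω hω ⟨hp, h1, h2⟩
    rw [R ω hω]
    constructor
    · intro h hG; exact h (Or.inl hG)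
    · rintro hG (h | ⟨-, ⟨h, -⟩ | ⟨h, -⟩⟩)
      · exact hG h
      · exact h1 h
      · exact h2 h)
  rw [real_offv_false, mul_zero] at b1 b2
  rw [real_state_oco (v := v) w ho1 ho2 h12] at b3
  rw [real_state_occ (v := v) w ho1 ho2 h12] at b4
  rw [real_state_coo (v := v) w ho1 ho2 h12] at b5
  rw [real_state_coc (v := v) w ho1 ho2 h12] at b6
  rw [real_state_cco (v := v) w ho1 ho2 h12] at b7
  rw [real_state_ccc (v := v) w ho1 ho2 h12] at b8
  rw [real_split₈ (prodBernoulli w) (openConn o u₁ : Set (BondConfig (Fin n)))ᶜ s(o, v) s(v, u₁) s(v, u₂)]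
  linarith [b1, b2, b3, b4, b5, b6, b7, b8]

/-- **Law of the cut at `u₂`** (the mirror image of `real_compl_openConn_u₁_eq`). [this work] -/
theorem real_compl_openConn_u₂_eq :
    (prodBernoulli w).real (openConn o u₂ : Set (BondConfig (Fin n)))ᶜ =
      (w s(o, v) : ℝ) * ((1 - w s(v, u₂)) * w s(v, u₁)) *
          (prodBernoulli w).real {ω : BondConfig (Fin n) |
            ¬ (openGraph (offZ {v} ω)).Reachable o u₂ ∧ ¬ (openGraph (offZ {v} ω)).Reachable u₁ u₂} +
        (1 - (w s(o, v) : ℝ)) * (w s(v, u₂) * w s(v, u₁)) *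
          (prodBernoulli w).real {ω : BondConfig (Fin n) |
            ¬ (openGraph (offZ {v} ω)).Reachable o u₁ ∧ ¬ (openGraph (offZ {v} ω)).Reachable o u₂} +
        ((w s(o, v) : ℝ) * ((1 - w s(v, u₂)) * (1 - w s(v, u₁))) + (1 - (w s(o, v) : ℝ)) * (w s(v, u₂) * (1 - w s(v, u₁))) +
            (1 - (w s(o, v) : ℝ)) * ((1 - w s(v, u₂)) * w s(v, u₁)) + (1 - (w s(o, v) : ℝ)) * ((1 - w s(v, u₂)) * (1 - w s(v, u₁)))) *
          (prodBernoulli w).real {ω : BondConfig (Fin n) | ¬ (openGraph (offZ {v} ω)).Reachable o u₂} := by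
  have h := real_compl_openConn_u₁_eq (u₁ := u₂) (u₂ := u₁) w (fun z ho h2 h1 hv => hw z ho h1 h2 hv) hov h2v h1v ho2 ho1 h12.symm
  have e : {ω : BondConfig (Fin n) | ¬ (openGraph (offZ {v} ω)).Reachable o u₂ ∧ ¬ (openGraph (offZ {v} ω)).Reachable o u₁} =
      {ω : BondConfig (Fin n) | ¬ (openGraph (offZ {v} ω)).Reachable o u₁ ∧ ¬ (openGraph (offZ {v} ω)).Reachable o u₂} := by
    ext ω; simp only [Set.mem_setOf_eq]; exact and_comm
  rw [e] at h
  exact h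

end Law

end Gate3

end Quant

end Summit.CriticalPhenomena.PercolationContinuityZ3.Theorems
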